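import Literature.NumberTheory.Irrationality.Fischler2002.Theoreme32ThreeFormsProofs
import Literature.NumberTheory.Irrationality.Fischler2002.Theoreme32ThreeDictionaryProofs
import Literature.NumberTheory.Irrationality.Fischler2002.Theoreme32StepProofs
import Literature.NumberTheory.Irrationality.Fischler2002.JnChiProofs
import Literature.NumberTheory.Irrationality.Fischler2002.JnFinitenessUpperProofs
import HarnessLib

/-!
# Fischler 2002, Théorème 3.2 — `n = 3`: the one-step invariances of `𝒥/N` for the FIVE moves `σ, ψ, ϑ̃, φ, χ₃`

Topic `Literature/NumberTheory/Irrationality/Fischler2002`. PROOFS ONLY (no definition, no statement). Brick toward the `n = 3` case of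
the named fact `theoreme32` (`RhinViolaGroupsGeneral.lean`): « il laisse stable `𝒥(p)/(a₁! a₂! a₃! b₁! b₂! b₃! (a₂+b₃−c₃)! (b₁+b₃−c₃)!)` »
[Fischler2002Polyzetas, §3 Théorème 3.2, `n = 3`]. With `N = rvNormaliser 3` (= Rhin–Viola's `h!j!k!l!m!q!r!s!` under the dictionary of
`Theoreme32ThreeDictionaryProofs.lean`) and `X = 𝓔₃`:
* `crit3_iff` — on `𝓔₃` Fischler's criterion is the non-negativity of the EIGHT parameter forms (codes `0,6,12,30,29,27,17,3` of
  `Theoreme32ThreeFormsProofs.lean`: `crit3_iff_forms`); `Jn_three_congr`, `normaliser_three_congr` — `𝒥₃`, `N` read live coordinates only.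
* FREE moves (no criterion hypothesis, criterion preserved both ways): `σ`, `ψ` (tree: `step_sigma`, `step_psi`) and the word
  `ϑ̃ = φσφσψσφσφσψσφ` (Rhin–Viola's `ϑ`: `Jn_three_theta` + `normaliser_thetaWord`) — packaged as `free_sigma`, `free_psi`,
  `free_thetaWord`, closed under products and inverses (`free_mul`, `free_inv`).
* HYPERGEOMETRIC moves (both end-points in the criterion): `φ` (tree: `step_phi`) and the word `χ₃ = ψφσφσφσψ`, which acts as the
  typed `chi 3` (`chiWord_coords`) — Euler's exchange in `x₃` (tree: `Jn_chi_holds`, ct-1 g29) against `normaliser_chi`: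
  `step_chi3`, `step_chiWord`; and CONJUGATES `θ⁻¹ξθ` of a hypergeometric move `ξ` by a free `θ` are again such moves (`step_conj`).
Cell `pub-zeta5`, seat ct-1 g34, 2026-08-28. [cite: Fischler2002Polyzetas, §3 Théorème 3.2 (n = 3)] [cite: RhinViola2001, §4 (4.1), (4.4)]

HONEST FRAMING (cell pub-zeta5): systematic search; no irrationality claim unless certified — identities between (possibly infinite)
integrals of non-negative functions and factorial bookkeeping; nothing about `ζ(5)`.
-/

noncomputable section

namespace Literature.NumberTheory.Irrationality.Fischler2002

namespace Theoreme32

open Equiv JnFinite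
open scoped ENNReal

/-! ### The criterion for `n = 3` on `𝓔₃`; `𝒥₃` and `N` read the live coordinates only -/

/-- **Fischler's criterion for `n = 3` on `𝓔₃`**: `a₁,a₂,a₃,b₁,b₂,b₃ ≥ 0`, `a₂+b₃−c₃ ≥ 0`, `b₁+b₃−c₃ ≥ 0` (`ρ₃ = c₃−b₃ ≤ a₂`,
`ρ₂ = −1−b₂ ≤ a₁`, `ρ₁ = (c₃−b₃)⁺ − b₁ ≤ 0`) — the eight Rhin–Viola parameters are non-negative.
[cite: Fischler2002Polyzetas, §3 p. 3 (critère de finitude), n = 3] [cite: RhinViola2001, §2 p. 271 (finiteness of (2.1))] -/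
theorem crit3_iff {p : Exponents} (hp : InE 3 p) :
    FinitenessCriterionGen 3 p ↔ 0 ≤ p.a 1 ∧ 0 ≤ p.a 2 ∧ 0 ≤ p.a 3 ∧ 0 ≤ p.b 1 ∧ 0 ≤ p.b 2 ∧ 0 ≤ p.b 3 ∧
      0 ≤ p.a 2 + p.b 3 - p.c 3 ∧ 0 ≤ p.b 1 + p.b 3 - p.c 3 := by
  have hc2 := hp.1 2 le_rfl (by norm_num)
  have hr3 : rho 3 p 3 = p.c 3 - p.b 3 := by
    rw [rho_of_le p (le_refl 3), rho_of_lt p (by norm_num : 3 < 5)]; simp [cTilde]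
  have hr2 : rho 3 p 2 = -1 - p.b 2 := by
    rw [rho_of_le p (by norm_num : 2 ≤ 3), rho_of_lt p (by norm_num : 3 < 4)]; simp [cTilde, hc2]
  have hr1 : rho 3 p 1 = max (p.c 3 - p.b 3) 0 - p.b 1 := by
    rw [rho_of_le p (by norm_num : 1 ≤ 3), hr3]; simp [cTilde]
  have hI : Finset.Icc 1 3 = {1, 2, 3} := by decide
  simp only [FinitenessCriterionGen, hI, Finset.mem_insert, Finset.mem_singleton, forall_eq_or_imp, forall_eq, hr1, hr2, hr3,
    if_true, show (2 : ℕ) ≠ 1 by norm_num, show (3 : ℕ) ≠ 1 by norm_num, if_false, show 2 - 1 = 1 from rfl, show 3 - 1 = 2 from rfl]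
  constructor
  · rintro ⟨⟨ha1, ha2, ha3⟩, ⟨hb1, hb2, hb3⟩, h1, -, h3⟩
    have := le_max_left (p.c 3 - p.b 3) 0
    exact ⟨ha1, ha2, ha3, hb1, hb2, hb3, by linarith, by linarith⟩
  · rintro ⟨ha1, ha2, ha3, hb1, hb2, hb3, h7, h8⟩
    refine ⟨⟨ha1, ha2, ha3⟩, ⟨hb1, hb2, hb3⟩, ?_, by linarith, by linarith⟩
    rcases le_total (p.c 3 - p.b 3) 0 with h | h
    · rw [max_eq_right h]; linarith
    · rw [max_eq_left h]; linarith

/-- `𝒥₃(p)` depends only on `a₁,a₂,a₃,b₁,b₂,b₃,c₂,c₃`. [cite: Fischler2002Polyzetas, §3 p. 3 (definition of 𝒥(p))] -/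
theorem Jn_three_congr {p q : Exponents} (ha : ∀ k, 1 ≤ k → k ≤ 3 → p.a k = q.a k) (hb : ∀ k, 1 ≤ k → k ≤ 3 → p.b k = q.b k)
    (hc : ∀ k, 2 ≤ k → k ≤ 3 → p.c k = q.c k) : Jn 3 p = Jn 3 q := by
  have hint : ∀ x, integrandJ 3 p x = integrandJ 3 q x := by
    intro x
    unfold integrandJ
    have h1 : ∏ k ∈ Finset.Icc 1 3, coord x k ^ p.a k * (1 - coord x k) ^ p.b k =
        ∏ k ∈ Finset.Icc 1 3, coord x k ^ q.a k * (1 - coord x k) ^ q.b k :=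
      Finset.prod_congr rfl fun k hk => by
        rw [ha k (Finset.mem_Icc.1 hk).1 (Finset.mem_Icc.1 hk).2, hb k (Finset.mem_Icc.1 hk).1 (Finset.mem_Icc.1 hk).2]
    have h2 : ∏ k ∈ Finset.Icc 2 3, deltaV x k ^ p.c k = ∏ k ∈ Finset.Icc 2 3, deltaV x k ^ q.c k :=
      Finset.prod_congr rfl fun k hk => by rw [hc k (Finset.mem_Icc.1 hk).1 (Finset.mem_Icc.1 hk).2]
    rw [h1, h2]
  unfold Jn
  simp_rw [hint]

/-- `N(p) = rvNormaliser 3 p` depends only on `a₁,a₂,a₃,b₁,b₂,b₃,c₃`. [cite: Fischler2002Polyzetas, §3 Théorème 3.2 (n = 3)] -/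
theorem normaliser_three_congr {p q : Exponents} (ha : ∀ k, 1 ≤ k → k ≤ 3 → p.a k = q.a k)
    (hb : ∀ k, 1 ≤ k → k ≤ 3 → p.b k = q.b k) (hc : p.c 3 = q.c 3) : rvNormaliser 3 p = rvNormaliser 3 q := by
  unfold rvNormaliser
  simp only [show (3 : ℕ) ≠ 2 by norm_num, if_false, if_true]
  rw [ha 1 le_rfl (by norm_num), ha 2 (by norm_num) (by norm_num), ha 3 (by norm_num) le_rfl, hb 1 le_rfl (by norm_num),
    hb 2 (by norm_num) (by norm_num), hb 3 (by norm_num) le_rfl, hc]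

/-- The criterion for `n = 3` reads only `a₁,a₂,a₃,b₁,b₂,b₃,c₂,c₃`. [cite: Fischler2002Polyzetas, §3 p. 3 (critère de finitude)] -/
theorem crit3_congr {p q : Exponents} (hp : InE 3 p) (hq : InE 3 q) (ha : ∀ k, 1 ≤ k → k ≤ 3 → p.a k = q.a k)
    (hb : ∀ k, 1 ≤ k → k ≤ 3 → p.b k = q.b k) (hc : p.c 3 = q.c 3) :
    FinitenessCriterionGen 3 p ↔ FinitenessCriterionGen 3 q := by
  rw [crit3_iff hp, crit3_iff hq, ha 1 le_rfl (by norm_num), ha 2 (by norm_num) (by norm_num), ha 3 (by norm_num) le_rfl,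
    hb 1 le_rfl (by norm_num), hb 2 (by norm_num) (by norm_num), hb 3 (by norm_num) le_rfl, hc]

/-! ### `χ` (Euler's exchange in `x₃`): the normaliser and the one-step invariance -/

/-- **`N(p)·c₃!·(a₃+b₃−c₃)! = N(χp)·a₃!·b₃!`** on `𝓔₃` (`χ`: `a₃ ↔ c₃`, `b₃ ↦ a₃+b₃−c₃`; the two mixed factorials are unchanged).
[cite: Fischler2002Polyzetas, §3 p. 3 (formule pour χ) and Théorème 3.2 (n = 3)] [cite: RhinViola2001, §4 p. 281 (χ)] -/
theorem normaliser_chi (p : Exponents) :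
    rvNormaliser 3 p * ((p.c 3).toNat.factorial * (p.a 3 + p.b 3 - p.c 3).toNat.factorial) =
      rvNormaliser 3 (chi 3 p) * ((p.a 3).toNat.factorial * (p.b 3).toNat.factorial) := by
  unfold rvNormaliser
  rw [show (chi 3 p).a 2 + (chi 3 p).b 3 - (chi 3 p).c 3 = p.a 2 + p.b 3 - p.c 3 by simp [chi]; ring,
    show (chi 3 p).b 1 + (chi 3 p).b 3 - (chi 3 p).c 3 = p.b 1 + p.b 3 - p.c 3 by simp [chi]; ring]
  simp [chi]; ring

/-- **`χ`-step**: if `p ∈ 𝓔₃` satisfies the criterion and `c₃ ≥ 0`, `a₃+b₃−c₃ ≥ 0` (the new parameters of `χp`) then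
`𝒥₃(χp)/N(χp) = 𝒥₃(p)/N(p)` — the tree's `Jn_chi_holds` (Euler's exchange in `x₃`) against `normaliser_chi`.
[cite: Fischler2002Polyzetas, §3 p. 3 (formule pour χ), Théorème 3.2] [cite: RhinViola2001, §4 (4.4)] -/
theorem step_chi3 {p : Exponents} (hc : FinitenessCriterionGen 3 p) (hcn : 0 ≤ p.c 3) (hs : 0 ≤ p.a 3 + p.b 3 - p.c 3) :
    Jn 3 (chi 3 p) / (rvNormaliser 3 (chi 3 p) : ℝ≥0∞) = Jn 3 p / (rvNormaliser 3 p : ℝ≥0∞) := by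
  have hE := Jn_chi_holds 3 p (by norm_num) hc hcn hs
  set F₁ : ℕ := (p.a 3).toNat.factorial * (p.b 3).toNat.factorial with hF₁
  set F₂ : ℕ := (p.c 3).toNat.factorial * (p.a 3 + p.b 3 - p.c 3).toNat.factorial with hF₂
  have hF₁pos : (0 : ℝ) < F₁ := by rw [hF₁]; positivity
  have hF₂pos : (0 : ℝ) < F₂ := by rw [hF₂]; positivity
  have hN := normaliser_chi p
  rw [← hF₁, ← hF₂] at hN
  have hNpos := rvNormaliser_pos 3 p
  have hN'pos := rvNormaliser_pos 3 (chi 3 p)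
  rw [ENNReal.div_eq_div_iff (by exact_mod_cast hNpos.ne') (ENNReal.natCast_ne_top _)
    (by exact_mod_cast hN'pos.ne') (ENNReal.natCast_ne_top _), hE, ← mul_assoc]
  congr 1
  have hreal : (rvNormaliser 3 p : ℝ) = (rvNormaliser 3 (chi 3 p) : ℝ) * ((F₁ : ℝ) / F₂) := by
    rw [eq_comm, mul_div_assoc', div_eq_iff hF₂pos.ne']
    exact_mod_cast hN.symm
  rw [← ENNReal.ofReal_natCast (rvNormaliser 3 p), hreal, ENNReal.ofReal_mul (by positivity), ENNReal.ofReal_natCast]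

section Moves

variable {F : Fin 32 → Exponents → ℤ}
  (hF : ∀ (c : Fin 32) (p : Exponents), F c p =
    ![p.b 1, 0, 0, p.b 2, 0, p.a 2 + p.b 2 - p.c 3, p.a 3, 0, 0, p.a 2 + p.b 3 - p.a 1, p.c 3, 0, p.a 2, 0, 0,
      p.a 2 + p.b 2 - p.b 1, 0, p.b 1 + p.b 3 - p.c 3, p.a 1 + p.b 1 - p.a 2, 0, p.a 1 + p.b 1 - p.c 3, 0, 0,
      p.a 3 + p.b 3 - p.c 3, p.a 1 + p.b 1 - p.a 3, 0, 0, p.b 3, 0, p.a 2 + p.b 3 - p.c 3, p.a 1, 0] c)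
  {A : Perm (Fin 5) → Fin 32 → Fin 32 → Fin 32}
  (hA : ∀ (s : Perm (Fin 5)) (t c : Fin 32), A s t c = Fin.ofNat 32
    ((if (Nat.testBit c.val (s.symm 0).val != Nat.testBit t.val 0) then 1 else 0) +
      (if (Nat.testBit c.val (s.symm 1).val != Nat.testBit t.val 1) then 2 else 0) +
      (if (Nat.testBit c.val (s.symm 2).val != Nat.testBit t.val 2) then 4 else 0) +
      (if (Nat.testBit c.val (s.symm 3).val != Nat.testBit t.val 3) then 8 else 0) +
      (if (Nat.testBit c.val (s.symm 4).val != Nat.testBit t.val 4) then 16 else 0)))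
  {gσ gψ gφ : Perm {p : Exponents // InE 3 p}}

/-! ### The criterion through the forms -/

include hF in
/-- On `𝓔₃` the criterion is `F_u(p) ≥ 0` for the eight parameter codes `u ∈ {0,6,12,30,29,27,17,3}`.
[cite: Fischler2002Polyzetas, §3 p. 3 (critère de finitude), n = 3] -/
theorem crit3_iff_forms (p : {p : Exponents // InE 3 p}) :
    FinitenessCriterionGen 3 p.1 ↔ ∀ u ∈ [(0 : Fin 32), 6, 12, 30, 29, 27, 17, 3], 0 ≤ F u p.1 := by
  rw [crit3_iff p.2]
  simp only [List.mem_cons, List.not_mem_nil, or_false, forall_eq_or_imp, forall_eq, hF]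
  simp only [Matrix.cons_val]
  tauto

include hF in
/-- **Criterion transfer along the forms.** If `g` acts through a map `π` of the codes sending the eight parameter codes to parameter
codes, then `g` preserves the criterion. [cite: Fischler2002Polyzetas, §3 Théorème 3.2 (n = 3)] -/
theorem crit3_of_perm_params {g : Perm {p : Exponents // InE 3 p}} {π : Fin 32 → Fin 32} (hg : ∀ c p, F c (g p).1 = F (π c) p.1)
    (hπ : ∀ u ∈ [(0 : Fin 32), 6, 12, 30, 29, 27, 17, 3], π u ∈ [(0 : Fin 32), 6, 12, 30, 29, 27, 17, 3])
    (p : {p : Exponents // InE 3 p}) (hc : FinitenessCriterionGen 3 p.1) : FinitenessCriterionGen 3 (g p).1 := by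
  rw [crit3_iff_forms hF] at hc ⊢
  intro u hu
  rw [hg]
  exact hc _ (hπ u hu)

/-! ### Free moves: `σ`, `ψ`, `ϑ̃`, their products and inverses -/

/-- **`σ` is a free move**: it preserves the criterion both ways and `𝒥₃/N`. [cite: Fischler2002Polyzetas, §3 Théorème 3.2 (n = 3)] -/
theorem free_sigma (hσ : ∀ p, (gσ p).1 = sigma p.1) (q : {p : Exponents // InE 3 p}) :
    (FinitenessCriterionGen 3 q.1 ↔ FinitenessCriterionGen 3 (gσ q).1) ∧
      (FinitenessCriterionGen 3 q.1 →
        Jn 3 (gσ q).1 / (rvNormaliser 3 (gσ q).1 : ℝ≥0∞) = Jn 3 q.1 / (rvNormaliser 3 q.1 : ℝ≥0∞)) := by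
  obtain ⟨-, h3, -⟩ := q.2
  have e := h3 rfl
  refine ⟨?_, fun _ => by rw [hσ q]; exact step_sigma (by norm_num) q.2⟩
  rw [crit3_iff q.2, crit3_iff (gσ q).2, hσ q]
  simp only [sigma, if_true, show (2 : ℕ) ≠ 1 by norm_num, show (3 : ℕ) ≠ 1 by norm_num, show (3 : ℕ) ≠ 2 by norm_num, if_false]
  constructor
  · rintro ⟨h1, h2, h3, h4, h5, h6, h7, h8⟩; exact ⟨h5, h4, h3, h2, h1, h6, by linarith, by linarith⟩
  · rintro ⟨h1, h2, h3, h4, h5, h6, h7, h8⟩; exact ⟨h5, h4, h3, h2, h1, h6, by linarith, by linarith⟩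

/-- **`ψ` is a free move.** [cite: Fischler2002Polyzetas, §3 Théorème 3.2 (n = 3)] -/
theorem free_psi (hψ : ∀ p, (gψ p).1 = psi 3 p.1) (q : {p : Exponents // InE 3 p}) :
    (FinitenessCriterionGen 3 q.1 ↔ FinitenessCriterionGen 3 (gψ q).1) ∧
      (FinitenessCriterionGen 3 q.1 →
        Jn 3 (gψ q).1 / (rvNormaliser 3 (gψ q).1 : ℝ≥0∞) = Jn 3 q.1 / (rvNormaliser 3 q.1 : ℝ≥0∞)) := by
  obtain ⟨-, h3, -⟩ := q.2
  have e := h3 rfl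
  refine ⟨?_, fun _ => by rw [hψ q]; exact step_psi (by norm_num) q.2⟩
  rw [crit3_iff q.2, crit3_iff (gψ q).2, hψ q]
  simp [psi]
  constructor
  · rintro ⟨h1, h2, h3, h4, h5, h6, h7, h8⟩; exact ⟨h3, h2, h1, h7, h6, h5, by linarith, by linarith⟩
  · rintro ⟨h1, h2, h3, h4, h5, h6, h7, h8⟩; exact ⟨h3, h2, h1, by linarith, h6, h5, h4, by linarith⟩

include hF hA in
/-- **`N(ϑ̃p) = N(p)` on `𝓔₃`**: Rhin–Viola's `ϑ` permutes the eight parameters cyclically.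
[cite: RhinViola2001, §2 p. 272 (ϑ = (h j k l m q r s))] [cite: Fischler2002Polyzetas, §3 Théorème 3.2 (n = 3)] -/
theorem normaliser_thetaWord (hσ : ∀ p, (gσ p).1 = sigma p.1) (hψ : ∀ p, (gψ p).1 = psi 3 p.1) (hφ : ∀ p, (gφ p).1 = phi 3 p.1)
    (q : {p : Exponents // InE 3 p}) :
    rvNormaliser 3 ((gφ * gσ * gφ * gσ * gψ * gσ * gφ * gσ * gφ * gσ * gψ * gσ * gφ) q).1 = rvNormaliser 3 q.1 := by
  obtain ⟨ha1, ha2, ha3, hb1, hb2, hb3, hc3⟩ := thetaWord_coords hF hA hσ hψ hφ q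
  obtain ⟨-, h3, -⟩ := q.2
  have e := h3 rfl
  unfold rvNormaliser
  simp only [show (3 : ℕ) ≠ 2 by norm_num, if_false, if_true]
  rw [ha1, ha2, ha3, hb1, hb2, hb3, hc3,
    show q.1.a 1 + (q.1.b 1 + q.1.b 3 - q.1.c 3) - (q.1.a 3 + q.1.b 1 + q.1.b 3 - q.1.b 2 - q.1.c 3) = q.1.b 3 by linarith,
    show q.1.a 3 + (q.1.b 1 + q.1.b 3 - q.1.c 3) - (q.1.a 3 + q.1.b 1 + q.1.b 3 - q.1.b 2 - q.1.c 3) = q.1.b 2 by ring]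
  ring

include hF hA in
/-- **`ϑ̃` is a free move**: it permutes the eight parameters (so preserves the criterion both ways) and, by Rhin–Viola's change of
variables (`Jn_three_theta`), preserves `𝒥₃`; hence `𝒥₃/N`. [cite: RhinViola2001, §2 p. 272] [cite: Fischler2002Polyzetas, §3 Théorème 3.2 (n = 3)] -/
theorem free_thetaWord (hσ : ∀ p, (gσ p).1 = sigma p.1) (hψ : ∀ p, (gψ p).1 = psi 3 p.1) (hφ : ∀ p, (gφ p).1 = phi 3 p.1)
    (q : {p : Exponents // InE 3 p}) :
    (FinitenessCriterionGen 3 q.1 ↔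
        FinitenessCriterionGen 3 ((gφ * gσ * gφ * gσ * gψ * gσ * gφ * gσ * gφ * gσ * gψ * gσ * gφ) q).1) ∧
      (FinitenessCriterionGen 3 q.1 →
        Jn 3 ((gφ * gσ * gφ * gσ * gψ * gσ * gφ * gσ * gφ * gσ * gψ * gσ * gφ) q).1 /
            (rvNormaliser 3 ((gφ * gσ * gφ * gσ * gψ * gσ * gφ * gσ * gφ * gσ * gψ * gσ * gφ) q).1 : ℝ≥0∞) =
          Jn 3 q.1 / (rvNormaliser 3 q.1 : ℝ≥0∞)) := by
  obtain ⟨ha1, ha2, ha3, hb1, hb2, hb3, hc3⟩ := thetaWord_coords hF hA hσ hψ hφ q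
  obtain ⟨-, h3, -⟩ := q.2
  have e := h3 rfl
  refine ⟨?_, fun _ => ?_⟩
  · rw [crit3_iff q.2, crit3_iff ((gφ * gσ * gφ * gσ * gψ * gσ * gφ * gσ * gφ * gσ * gψ * gσ * gφ) q).2, ha1, ha2, ha3, hb1,
      hb2, hb3, hc3]
    constructor
    · rintro ⟨h1, h2, h3, h4, h5, h6, h7, h8⟩; exact ⟨h7, h1, h2, h3, h4, h8, by linarith, by linarith⟩
    · rintro ⟨h1, h2, h3, h4, h5, h6, h7, h8⟩; exact ⟨h2, h3, h4, h5, by linarith, by linarith, h1, h6⟩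
  · rw [normaliser_thetaWord hF hA hσ hψ hφ q,
      Jn_three_theta_of_InE q.2 ((gφ * gσ * gφ * gσ * gψ * gσ * gφ * gσ * gφ * gσ * gψ * gσ * gφ) q).2 ha1 ha2 ha3 hb1 hb2 hb3 hc3]

/-- **Free moves compose.** [cite: Fischler2002Polyzetas, §3 Théorème 3.2 (n = 3)] -/
theorem free_mul {θ θ' : Perm {p : Exponents // InE 3 p}}
    (hθ : ∀ q, (FinitenessCriterionGen 3 q.1 ↔ FinitenessCriterionGen 3 (θ q).1) ∧ (FinitenessCriterionGen 3 q.1 →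
      Jn 3 (θ q).1 / (rvNormaliser 3 (θ q).1 : ℝ≥0∞) = Jn 3 q.1 / (rvNormaliser 3 q.1 : ℝ≥0∞)))
    (hθ' : ∀ q, (FinitenessCriterionGen 3 q.1 ↔ FinitenessCriterionGen 3 (θ' q).1) ∧ (FinitenessCriterionGen 3 q.1 →
      Jn 3 (θ' q).1 / (rvNormaliser 3 (θ' q).1 : ℝ≥0∞) = Jn 3 q.1 / (rvNormaliser 3 q.1 : ℝ≥0∞)))
    (q : {p : Exponents // InE 3 p}) :
    (FinitenessCriterionGen 3 q.1 ↔ FinitenessCriterionGen 3 ((θ * θ') q).1) ∧ (FinitenessCriterionGen 3 q.1 →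
      Jn 3 ((θ * θ') q).1 / (rvNormaliser 3 ((θ * θ') q).1 : ℝ≥0∞) = Jn 3 q.1 / (rvNormaliser 3 q.1 : ℝ≥0∞)) := by
  rw [Perm.mul_apply]
  refine ⟨(hθ' q).1.trans (hθ (θ' q)).1, fun hc => ?_⟩
  rw [(hθ (θ' q)).2 ((hθ' q).1.1 hc), (hθ' q).2 hc]

/-- **Inverses of free moves are free.** [cite: Fischler2002Polyzetas, §3 Théorème 3.2 (n = 3)] -/
theorem free_inv {θ : Perm {p : Exponents // InE 3 p}}
    (hθ : ∀ q, (FinitenessCriterionGen 3 q.1 ↔ FinitenessCriterionGen 3 (θ q).1) ∧ (FinitenessCriterionGen 3 q.1 →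
      Jn 3 (θ q).1 / (rvNormaliser 3 (θ q).1 : ℝ≥0∞) = Jn 3 q.1 / (rvNormaliser 3 q.1 : ℝ≥0∞)))
    (q : {p : Exponents // InE 3 p}) :
    (FinitenessCriterionGen 3 q.1 ↔ FinitenessCriterionGen 3 (θ⁻¹ q).1) ∧ (FinitenessCriterionGen 3 q.1 →
      Jn 3 (θ⁻¹ q).1 / (rvNormaliser 3 (θ⁻¹ q).1 : ℝ≥0∞) = Jn 3 q.1 / (rvNormaliser 3 q.1 : ℝ≥0∞)) := by
  have h := hθ (θ⁻¹ q)
  rw [← Perm.mul_apply, mul_inv_cancel, Perm.one_apply] at h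
  exact ⟨h.1.symm, fun hc => (h.2 (h.1.2 hc)).symm⟩

/-! ### Hypergeometric moves: `φ`, `χ₃`, and their conjugates by free moves -/

/-- **`φ`-step** (tree: `step_phi`): both end-points in the criterion. [cite: Fischler2002Polyzetas, §3 Théorème 3.2 (formule pour φ)] -/
theorem step_phi3 (hφ : ∀ p, (gφ p).1 = phi 3 p.1) (q : {p : Exponents // InE 3 p}) (hc : FinitenessCriterionGen 3 q.1)
    (hc' : FinitenessCriterionGen 3 (gφ q).1) :
    Jn 3 (gφ q).1 / (rvNormaliser 3 (gφ q).1 : ℝ≥0∞) = Jn 3 q.1 / (rvNormaliser 3 q.1 : ℝ≥0∞) := by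
  rw [hφ q] at hc' ⊢
  exact step_phi (by norm_num) q.2 hc hc'

include hF hA in
/-- **`χ₃`-step**: the word `χ₃ = ψφσφσφσψ` acts as the typed `chi 3` on `𝓔₃`, so for both end-points in the criterion
`𝒥₃(χ₃q)/N(χ₃q) = 𝒥₃(q)/N(q)` (`step_chi3`). [cite: Fischler2002Polyzetas, §3 p. 3 (formule pour χ), Théorème 3.2 (n = 3)] -/
theorem step_chiWord (hσ : ∀ p, (gσ p).1 = sigma p.1) (hψ : ∀ p, (gψ p).1 = psi 3 p.1) (hφ : ∀ p, (gφ p).1 = phi 3 p.1)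
    (q : {p : Exponents // InE 3 p}) (hc : FinitenessCriterionGen 3 q.1)
    (hc' : FinitenessCriterionGen 3 ((gψ * gφ * gσ * gφ * gσ * gφ * gσ * gψ) q).1) :
    Jn 3 ((gψ * gφ * gσ * gφ * gσ * gφ * gσ * gψ) q).1 / (rvNormaliser 3 ((gψ * gφ * gσ * gφ * gσ * gφ * gσ * gψ) q).1 : ℝ≥0∞) =
      Jn 3 q.1 / (rvNormaliser 3 q.1 : ℝ≥0∞) := by
  obtain ⟨ha1, ha2, ha3, hb1, hb2, hb3, hc3⟩ := chiWord_coords hF hA hσ hψ hφ q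
  have ha : ∀ k, 1 ≤ k → k ≤ 3 → ((gψ * gφ * gσ * gφ * gσ * gφ * gσ * gψ) q).1.a k = (chi 3 q.1).a k := by
    intro k hk hk'
    interval_cases k
    · rw [ha1]; simp [chi]
    · rw [ha2]; simp [chi]
    · rw [ha3]; simp [chi]
  have hb : ∀ k, 1 ≤ k → k ≤ 3 → ((gψ * gφ * gσ * gφ * gσ * gφ * gσ * gψ) q).1.b k = (chi 3 q.1).b k := by
    intro k hk hk'
    interval_cases k
    · rw [hb1]; simp [chi]
    · rw [hb2]; simp [chi]
    · rw [hb3]; simp [chi]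
  have hcc : ∀ k, 2 ≤ k → k ≤ 3 → ((gψ * gφ * gσ * gφ * gσ * gφ * gσ * gψ) q).1.c k = (chi 3 q.1).c k := by
    intro k hk hk'
    interval_cases k
    · rw [((gψ * gφ * gσ * gφ * gσ * gφ * gσ * gψ) q).2.1 2 le_rfl (by norm_num)]
      simp [chi, q.2.1 2 le_rfl (by norm_num)]
    · rw [hc3]; simp [chi]
  have h0 := (crit3_iff ((gψ * gφ * gσ * gφ * gσ * gφ * gσ * gψ) q).2).1 hc'
  rw [ha3, hb3] at h0
  rw [Jn_three_congr ha hb hcc, normaliser_three_congr ha hb (hcc 3 (by norm_num) le_rfl)]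
  exact step_chi3 hc h0.2.2.1 h0.2.2.2.2.2.1

/-- **Conjugating a hypergeometric move by a free move gives a hypergeometric move**: if `θ` is free and `ξ` preserves `𝒥₃/N`
between criterion points, so does `θ⁻¹ξθ`. [cite: Fischler2002Polyzetas, §3 Théorème 3.2 (n = 3)] [cite: RhinViola2001, §4 (4.4)] -/
theorem step_conj {θ ξ : Perm {p : Exponents // InE 3 p}}
    (hθ : ∀ q, (FinitenessCriterionGen 3 q.1 ↔ FinitenessCriterionGen 3 (θ q).1) ∧ (FinitenessCriterionGen 3 q.1 →
      Jn 3 (θ q).1 / (rvNormaliser 3 (θ q).1 : ℝ≥0∞) = Jn 3 q.1 / (rvNormaliser 3 q.1 : ℝ≥0∞)))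
    (hξ : ∀ q, FinitenessCriterionGen 3 q.1 → FinitenessCriterionGen 3 (ξ q).1 →
      Jn 3 (ξ q).1 / (rvNormaliser 3 (ξ q).1 : ℝ≥0∞) = Jn 3 q.1 / (rvNormaliser 3 q.1 : ℝ≥0∞))
    (q : {p : Exponents // InE 3 p}) (hc : FinitenessCriterionGen 3 q.1) (hc' : FinitenessCriterionGen 3 ((θ⁻¹ * ξ * θ) q).1) :
    Jn 3 ((θ⁻¹ * ξ * θ) q).1 / (rvNormaliser 3 ((θ⁻¹ * ξ * θ) q).1 : ℝ≥0∞) = Jn 3 q.1 / (rvNormaliser 3 q.1 : ℝ≥0∞) := by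
  have hθq := hθ q
  have e : (θ⁻¹ * ξ * θ) q = θ⁻¹ (ξ (θ q)) := by simp [Perm.mul_apply]
  rw [e] at hc' ⊢
  have hfi := free_inv hθ (ξ (θ q))
  -- the point `ξ(θq) = θ (θ⁻¹ξθ q)` is in the criterion
  have hcξ : FinitenessCriterionGen 3 (ξ (θ q)).1 := hfi.1.2 hc'
  rw [hfi.2 hcξ, hξ (θ q) (hθq.1.1 hc) hcξ, hθq.2 hc]

end Moves

end Theoreme32

end Literature.NumberTheory.Irrationality.Fischler2002

end
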